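import Summits.QuantumFields.QCD.Theses.PauliWegnerSea
import Literature.MathematicalPhysics.QuantumFieldTheory.QCDPhaseQuenched

/-!
# Crux `GluonicCompletion` (stmt-QuantumFields-9152), line `finite-sign-budget-at-the-scheme-volume` — helper stubs for `stub_detNonvanishing_of`

Three self-contained pieces of the lead's assembly of the a.e. non-vanishing of the Wilson determinant
(registered sub-goals `stub_trigDichotomy`, `stub_haarWordIterate`, `stub_linkWordSurjective`):
* the one-variable dichotomy — a trigonometric polynomial `θ ↦ p(e^{iθ})e^{-iNθ}` vanishes identically or on
  a Lebesgue-null set (its zeros lie over the finitely many roots of `p`, and the fibres of `θ ↦ e^{iθ}` are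
  countable);
* the iteration of the right-invariant averaging step along a list of curves — for a family `P` of closed sets
  and a family `Q` of continuous curves such that every `P`-set satisfies the dichotomy along every `Q`-curve and
  averaging keeps `P`, the averaged set over all words `c₁(θ₁)⋯c_r(θ_r)` is in `P` and has the measure of `Z`;
* surjectivity of the one-link words — if nine curves generate `SU(3)` as the word `L₀(θ₀)⋯L₈(θ₈)`, then every
  gauge configuration is a word in the one-link letters `δ_e ∘ L_j` over all edges (it is the product over the
  edges of its one-link pieces `δ_e(V_e)`).
-/

noncomputable section

namespace Summit.QuantumFields.QCD.Theorems.FiniteSignBudgetAtTheSchemeVolume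

open scoped BigOperators Topology ENNReal
open MeasureTheory Filter Complex
open Literature.MathematicalPhysics.QuantumFieldTheory Literature.MathematicalPhysics.QuantumLattice
  Literature.Probability.LatticeModels

/-! ### The one-variable dichotomy for trigonometric polynomials -/

/-- The fibres of `θ ↦ e^{iθ}` are countable (`e^{iθ} = e^{iθ₀} ⇒ θ ∈ θ₀ + 2πℤ`). [folklore] -/
private theorem countable_exp_fibre (z : ℂ) : {θ : ℝ | cexp (θ * I) = z}.Countable := by
  by_cases hz : ∃ θ₀ : ℝ, cexp (θ₀ * I) = z
  · obtain ⟨θ₀, hθ₀⟩ := hz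
    refine (Set.countable_range fun n : ℤ => θ₀ + n * (2 * Real.pi)).mono ?_
    intro θ hθ
    have h : cexp (θ * I) = cexp (θ₀ * I) := by rw [hθ₀]; exact hθ
    obtain ⟨n, hn⟩ := Complex.exp_eq_exp_iff_exists_int.1 h
    refine ⟨n, ?_⟩
    have hre := congrArg Complex.im hn
    simp at hre
    linarith
  · convert Set.countable_empty
    ext θ
    simp only [Set.mem_setOf_eq, Set.mem_empty_iff_false, iff_false]
    exact fun h => hz ⟨θ, h⟩

/-- **Dichotomy.** A trigonometric polynomial `θ ↦ p(e^{iθ}) e^{-iNθ}` vanishes identically or on a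
Lebesgue-null set of parameters (its zeros lie over the finitely many roots of `p`). [folklore] -/
private theorem trigDichotomy_impl (N : ℕ) (p : Polynomial ℂ) :
    (∀ θ : ℝ, p.eval (cexp (θ * I)) * cexp (-(N * θ * I)) = 0) ∨
      volume {θ : ℝ | p.eval (cexp (θ * I)) * cexp (-(N * θ * I)) = 0} = 0 := by
  by_cases hp : p = 0
  · exact Or.inl fun θ => by simp [hp]
  · refine Or.inr (Set.Countable.measure_zero ?_ _)
    have hsub : {θ : ℝ | p.eval (cexp (θ * I)) * cexp (-(N * θ * I)) = 0} ⊆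
        ⋃ z ∈ p.roots.toFinset, {θ : ℝ | cexp (θ * I) = z} := by
      intro θ hθ
      simp only [Set.mem_setOf_eq, mul_eq_zero, Complex.exp_ne_zero, or_false] at hθ
      simp only [Set.mem_iUnion, Set.mem_setOf_eq, Multiset.mem_toFinset]
      exact ⟨cexp (θ * I), (Polynomial.mem_roots hp).2 hθ, rfl⟩
    exact ((p.roots.toFinset.countable_toSet).biUnion fun z _ => countable_exp_fibre z).mono hsub

/-! ### Iterating the averaging step along a list of curves -/

/-- **Iteration of the averaging step.** Let `P` be a family of closed sets and `Q` a family of continuous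
curves such that along every `Q`-curve every `P`-set satisfies the dichotomy of the averaging step and the
averaged set `{g | ∀ θ, g·c(θ) ∈ Z}` is again in `P`.  Then for every list `cs` of `Q`-curves and every `Z ∈ P`
the set `Z* = {g | ∀ θs, g · c₁(θ₁)⋯c_r(θ_r) ∈ Z}` is in `P` and has the same measure as `Z` (induction on the
list: `Z*_{c :: cs} = {g | ∀ θ, g·c(θ) ∈ Z*_{cs}}`). [folklore] -/
private theorem haarWordIterate_impl (G : Type) [Group G] [TopologicalSpace G] [IsTopologicalGroup G]
    [MeasurableSpace G] [BorelSpace G] (μ : Measure G) [IsFiniteMeasure μ] [μ.IsMulRightInvariant]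
    (hstep : ∀ (c : ℝ → G), Continuous c → ∀ Z : Set G, IsClosed Z →
      (∀ g : G, (∀ θ : ℝ, g * c θ ∈ Z) ∨ volume {θ : ℝ | g * c θ ∈ Z} = 0) →
        μ Z = μ {g : G | ∀ θ : ℝ, g * c θ ∈ Z})
    (P : Set G → Prop) (Q : (ℝ → G) → Prop) (hQ : ∀ c, Q c → Continuous c)
    (hP : ∀ Z, P Z → IsClosed Z)
    (hdich : ∀ Z, P Z → ∀ c, Q c → ∀ g : G, (∀ θ : ℝ, g * c θ ∈ Z) ∨ volume {θ : ℝ | g * c θ ∈ Z} = 0)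
    (hstab : ∀ Z, P Z → ∀ c, Q c → P {g : G | ∀ θ : ℝ, g * c θ ∈ Z})
    (cs : List (ℝ → G)) (hcs : ∀ c ∈ cs, Q c) (Z : Set G) (hZ : P Z) :
    P {g : G | ∀ θs : List ℝ, θs.length = cs.length →
        g * (List.zipWith (fun c θ => c θ) cs θs).prod ∈ Z} ∧
      μ Z = μ {g : G | ∀ θs : List ℝ, θs.length = cs.length →
        g * (List.zipWith (fun c θ => c θ) cs θs).prod ∈ Z} := by
  induction cs with
  | nil =>
    have hset : {g : G | ∀ θs : List ℝ, θs.length = ([] : List (ℝ → G)).length →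
        g * (List.zipWith (fun c θ => c θ) ([] : List (ℝ → G)) θs).prod ∈ Z} = Z := by
      ext g
      simp only [List.length_nil, List.length_eq_zero_iff, List.zipWith_nil_left, List.prod_nil,
        mul_one, forall_eq, Set.mem_setOf_eq]
    rw [hset]
    exact ⟨hZ, rfl⟩
  | cons c cs ih =>
    have hc : Q c := hcs c (by simp)
    obtain ⟨hPs, hμ⟩ := ih fun c' hc' => hcs c' (by simp [hc'])
    set Zs : Set G := {g : G | ∀ θs : List ℝ, θs.length = cs.length →
        g * (List.zipWith (fun c θ => c θ) cs θs).prod ∈ Z} with hZs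
    have hT : {g : G | ∀ θs : List ℝ, θs.length = (c :: cs).length →
        g * (List.zipWith (fun c θ => c θ) (c :: cs) θs).prod ∈ Z} = {g : G | ∀ θ : ℝ, g * c θ ∈ Zs} := by
      ext g
      simp only [hZs, Set.mem_setOf_eq, List.length_cons]
      constructor
      · intro hg θ θs hlen
        have := hg (θ :: θs) (by simp [hlen])
        simpa only [List.zipWith_cons_cons, List.prod_cons, mul_assoc] using this
      · intro hg θs hlen
        cases θs with
        | nil => simp at hlen
        | cons θ θs' =>
          simp only [List.length_cons, Nat.add_right_cancel_iff] at hlen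
          simpa only [List.zipWith_cons_cons, List.prod_cons, mul_assoc] using hg θ θs' hlen
    rw [hT, hμ]
    exact ⟨hstab Zs hPs c hc, hstep c (hQ c hc) Zs (hP Zs hPs) (hdich Zs hPs c hc)⟩

/-! ### Words: every configuration is a product of letters -/

/-- A configuration is the product over a duplicate-free list of edges of its one-link pieces (off the list
the product is `1`). [folklore] -/
private theorem prod_map_mulSingle {ι M : Type*} [DecidableEq ι] [Monoid M] (V : ι → M) (es : List ι)
    (hes : es.Nodup) :
    (es.map fun e => Pi.mulSingle e (V e)).prod = fun e' => if e' ∈ es then V e' else 1 := by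
  induction es with
  | nil => ext e'; simp
  | cons e es ih =>
    rw [List.nodup_cons] at hes
    rw [List.map_cons, List.prod_cons, ih hes.2]
    ext e'
    rw [Pi.mul_apply]
    by_cases h : e' = e
    · subst h
      simp [hes.1]
    · simp [h]

/-- A configuration is the product over a complete duplicate-free list of edges of its one-link pieces.
[folklore] -/
private theorem prod_map_mulSingle_eq_self {ι M : Type*} [DecidableEq ι] [Monoid M] (V : ι → M)
    (es : List ι) (hes : es.Nodup) (hall : ∀ e', e' ∈ es) :
    (es.map fun e => Pi.mulSingle e (V e)).prod = V := by
  rw [prod_map_mulSingle V es hes]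
  funext e'
  simp [hall e']

/-- `zipWith` of two `ofFn` lists of the same length. [folklore] -/
private theorem zipWith_ofFn {α β γ : Type*} {n : ℕ} (f : Fin n → α) (g : Fin n → β) (F : α → β → γ) :
    List.zipWith F (List.ofFn f) (List.ofFn g) = List.ofFn fun i => F (f i) (g i) := by
  induction n with
  | zero => simp
  | succ n ih => simp [List.ofFn_succ, ih]

/-- **Surjectivity of the words.** If nine curves `L j : ℝ → SU(3)` generate every element of `SU(3)` as the
word `L₀(θ₀)⋯L₈(θ₈)`, then for every list of edges `es` and every configuration `V` the list of one-link
letters `δ_e ∘ L_j` (`e ∈ es`, `j < 9`) produces the product over `es` of the one-link pieces of `V`.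
[folklore] -/
private theorem exists_word {S : ℕ} [NeZero S] (L : Fin 9 → ℝ → SU3)
    (hL : ∀ x : SU3, ∃ θ : Fin 9 → ℝ,
      x = L 0 (θ 0) * L 1 (θ 1) * L 2 (θ 2) * L 3 (θ 3) * L 4 (θ 4) * L 5 (θ 5) * L 6 (θ 6) * L 7 (θ 7) *
        L 8 (θ 8))
    (es : List (Edge 4 S)) (V : GaugeConfig 4 S SU3) :
    ∃ θs : List ℝ,
      θs.length = (es.flatMap fun e => List.ofFn fun j : Fin 9 => fun θ : ℝ =>
        (Pi.mulSingle e (L j θ) : GaugeConfig 4 S SU3)).length ∧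
      (List.zipWith (fun c θ => c θ) (es.flatMap fun e => List.ofFn fun j : Fin 9 => fun θ : ℝ =>
        (Pi.mulSingle e (L j θ) : GaugeConfig 4 S SU3)) θs).prod =
        (es.map fun e => (Pi.mulSingle e (V e) : GaugeConfig 4 S SU3)).prod := by
  induction es with
  | nil => exact ⟨[], by simp, by simp⟩
  | cons e es ih =>
    obtain ⟨θs', hlen', hprod'⟩ := ih
    obtain ⟨θ, hθ⟩ := hL (V e)
    refine ⟨List.ofFn θ ++ θs', ?_, ?_⟩
    · simp [hlen']
    · rw [List.flatMap_cons, List.zipWith_append (by simp), List.prod_append, hprod', List.map_cons,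
        List.prod_cons, zipWith_ofFn]
      congr 1
      rw [hθ]
      simp only [List.ofFn_succ, List.ofFn_zero, List.prod_cons, List.prod_nil, mul_one,
        Fin.succ_zero_eq_one, Fin.succ_one_eq_two, Pi.mulSingle_mul, mul_assoc]
      rfl

/-- **Surjectivity of the one-link words over all edges.** If nine curves `L j : ℝ → SU(3)` generate every
element of `SU(3)` as the word `L₀(θ₀)⋯L₈(θ₈)`, then every configuration `V` is the value of the word in the
one-link letters `δ_e ∘ L_j` listed over all edges of the torus (`V` is the product over the complete
duplicate-free list of edges of its one-link pieces `δ_e(V_e)`). [folklore] -/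
private theorem linkWordSurjective_impl (S : ℕ) [NeZero S] (L : Fin 9 → ℝ → SU3)
    (hL : ∀ x : SU3, ∃ θ : Fin 9 → ℝ,
      x = L 0 (θ 0) * L 1 (θ 1) * L 2 (θ 2) * L 3 (θ 3) * L 4 (θ 4) * L 5 (θ 5) * L 6 (θ 6) * L 7 (θ 7) *
        L 8 (θ 8))
    (V : GaugeConfig 4 S SU3) :
    ∃ θs : List ℝ,
      θs.length = ((Finset.univ : Finset (Edge 4 S)).toList.flatMap fun e => List.ofFn fun j : Fin 9 =>
        fun θ : ℝ => (Pi.mulSingle e (L j θ) : GaugeConfig 4 S SU3)).length ∧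
      (List.zipWith (fun c θ => c θ) ((Finset.univ : Finset (Edge 4 S)).toList.flatMap fun e =>
        List.ofFn fun j : Fin 9 => fun θ : ℝ => (Pi.mulSingle e (L j θ) : GaugeConfig 4 S SU3)) θs).prod = V := by
  obtain ⟨θs, hlen, hprod⟩ := exists_word L hL (Finset.univ : Finset (Edge 4 S)).toList V
  refine ⟨θs, hlen, ?_⟩
  rw [hprod]
  exact prod_map_mulSingle_eq_self V _ (Finset.nodup_toList _)
    fun e' => Finset.mem_toList.2 (Finset.mem_univ e')

/-! ### The registered statements (verbatim) -/

/-- **Registered sub-goal `stub_trigDichotomy`** (verbatim): a trigonometric polynomial `θ ↦ p(e^{iθ})e^{-iNθ}`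
vanishes identically or on a Lebesgue-null set. [folklore] -/
theorem stub_trigDichotomy :
    open MeasureTheory in ∀ (N : ℕ) (p : Polynomial ℂ), (∀ θ : ℝ, p.eval (Complex.exp (θ * Complex.I)) * Complex.exp (-(N * θ * Complex.I)) = 0) ∨ volume {θ : ℝ | p.eval (Complex.exp (θ * Complex.I)) * Complex.exp (-(N * θ * Complex.I)) = 0} = 0 :=
  trigDichotomy_impl

/-- **Registered sub-goal `stub_haarWordIterate`** (verbatim): iteration of the right-invariant averaging step
along a list of curves, keeping a class of closed sets. [folklore] -/
theorem stub_haarWordIterate :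
    open MeasureTheory in ∀ (G : Type) [Group G] [TopologicalSpace G] [IsTopologicalGroup G] [MeasurableSpace G] [BorelSpace G] (μ : Measure G) [IsFiniteMeasure μ] [μ.IsMulRightInvariant], (∀ (c : ℝ → G), Continuous c → ∀ Z : Set G, IsClosed Z → (∀ g : G, (∀ θ : ℝ, g * c θ ∈ Z) ∨ volume {θ : ℝ | g * c θ ∈ Z} = 0) → μ Z = μ {g : G | ∀ θ : ℝ, g * c θ ∈ Z}) → ∀ (P : Set G → Prop) (Q : (ℝ → G) → Prop), (∀ c, Q c → Continuous c) → (∀ Z, P Z → IsClosed Z) → (∀ Z, P Z → ∀ c, Q c → ∀ g : G, (∀ θ : ℝ, g * c θ ∈ Z) ∨ volume {θ : ℝ | g * c θ ∈ Z} = 0) → (∀ Z, P Z → ∀ c, Q c → P {g : G | ∀ θ : ℝ, g * c θ ∈ Z}) → ∀ (cs : List (ℝ → G)), (∀ c ∈ cs, Q c) → ∀ (Z : Set G), P Z → P {g : G | ∀ θs : List ℝ, θs.length = cs.length → g * (List.zipWith (fun c θ => c θ) cs θs).prod ∈ Z} ∧ μ Z = μ {g : G | ∀ θs : List ℝ, θs.length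 = cs.length → g * (List.zipWith (fun c θ => c θ) cs θs).prod ∈ Z} :=
  fun G _ _ _ _ _ μ _ _ hstep P Q hQ hP hdich hstab cs hcs Z hZ =>
    haarWordIterate_impl G μ hstep P Q hQ hP hdich hstab cs hcs Z hZ

/-- **Registered sub-goal `stub_linkWordSurjective`** (verbatim): every gauge configuration is a word in the
one-link letters over all edges, once nine curves generate `SU(3)`. [folklore] -/
theorem stub_linkWordSurjective :
    open Literature.MathematicalPhysics.QuantumFieldTheory in ∀ (S : ℕ) [NeZero S] (L : Fin 9 → ℝ → SU3), (∀ x : SU3, ∃ θ : Fin 9 → ℝ, x = L 0 (θ 0) * L 1 (θ 1) * L 2 (θ 2) * L 3 (θ 3) * L 4 (θ 4) * L 5 (θ 5) * L 6 (θ 6) * L 7 (θ 7) * L 8 (θ 8)) → ∀ (V : GaugeConfig 4 S SU3), ∃ θs : List ℝ, θs.length = ((Finset.univ : Finset (Edge 4 S)).toList.flatMap fun e => List.ofFn fun j : Fin 9 => fun θ : ℝ => (Pi.mulSingle e (L j θ) : GaugeConfig 4 S SU3)).length ∧ (List.zipWith (fun c θ => c θ) ((Finset.univ : Finset (Edge 4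 S)).toList.flatMap fun e => List.ofFn fun j : Fin 9 => fun θ : ℝ => (Pi.mulSingle e (L j θ) : GaugeConfig 4 S SU3)) θs).prod = V :=
  fun S _ L hL V => linkWordSurjective_impl S L hL V

end Summit.QuantumFields.QCD.Theorems.FiniteSignBudgetAtTheSchemeVolume

end
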